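import Literature.Probability.Percolation.ConditionalPositiveAssociationProofs
import Literature.Probability.Percolation.TwoClusterConditionalAssociation
import HarnessLib

/-!
# Correlation of admissible cluster events with decreasing cluster events (two-set form)

Let `G` be a finite graph with independent bond percolation (edge `e` open with probability
`w e`), `y ≠ z` two vertices, `X, Y ⊆ V`, `T` a family of vertex sets, and `h ≥ 0` a decreasing
function of the open edge cluster `C_y` of `y`.  Write `R_W = {y ↮ W}` and call the event
`A(X) = {C_z meets X} ∪ {V(C_z) ∈ T, y ∉ V(C_z)}` (*`X`-captures of `z`, or a free cluster of `z`
of a prescribed shape*) an **admissible** event.  Then (`admissible_twoSet`)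

`E[1_{A(X)} ; R_X] · E[h(C_y) ; R_Y] ≤ P(R_{X ∩ Y}) · E[1_{A(X)} h(C_y) ; R_{X ∪ Y}]`.

For `X = Y = {x}` this says that, conditionally on `{y ↮ x}`, every admissible event is positively
correlated with every decreasing event of `C_y` (`admissible_cov_nonneg`); for `A = Ω` it is the
decreasing-functional companion of van den Berg–Häggström–Kahn's Theorem 1.1.

The proof is van den Berg–Häggström–Kahn's induction for their Theorem 1.1
[cite: VandenbergHaggstromKahn2005, Thm. 1.1, proof pp. 3–5] run verbatim for the two-set form
above: the step conditions on the set `S` of vertices joined to `Z = X ∩ Y` by an open edge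
(BHK's identity (6), here `BHK2006.step_sum` and its admissible analogue `BHK2006.step_sum_adm`,
which uses the one extra fact that `X`-captures are increasing in `X` and transform under (6)
exactly like `R_X`), and applies the four functions theorem with the induction hypothesis in
`G − Z`; the base case `X ∩ Y = ∅` decomposes according to the vertex cluster `B` of `z`
(given `V(C_z) = B ∌ y`, the configuration off `B` is percolation on `G − B`, where `R_{X∖B}` and
`h(C_y) 1_{R_{Y∖B}}` are decreasing, hence positively correlated by Harris' inequality, and
dominate their `G`-versions).  The case `z ∈ X` (`A = Ω`) is BHK's Theorem 1.1 combined with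
their Theorem 1.2 for decreasing functions (`BHK2006.core_anti`).

This is the `m = 2` "adaptive selection" covariance lemma used on the near-critical gluing route
(`Summits/CriticalPhenomena/PercNearOne`, crux `NoHeavyLowerTail`): with `x = x₁`, `y = x₂` the two
observers and `z` the marker it gives `Cov(1{z ∈ C_{x₁}} ∪ {C_z free of shape T}, 1{C_{x₂} light} |
x₁ ↮ x₂) ≥ 0`.

## References
* [VandenbergHaggstromKahn2005] J. van den Berg, O. Häggström, J. Kahn, *Some conditional
  correlation inequalities for percolation and related processes*, Random Structures Algorithms
  29 (2006) 417–435, Theorems 1.1–1.3 and the proof of Theorem 1.1 (pp. 3–5 of the preprint).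
-/

open MeasureTheory unitInterval
open Literature.Probability.LatticeModels (prodBernoulli)

namespace Literature.Probability.Percolation

namespace BHK2006

open scoped Classical
open DecisionTree (ind ind_of_mem ind_of_not_mem ind_nonneg)

section Graph

variable {V : Type*}

/-! ### The vertex cluster of `z` in `G[U]` and admissible events -/

/-- The vertex set of the open cluster of `z` for percolation restricted to `U` (it always
contains `z`). [cite: VandenbergHaggstromKahn2005, §1 p. 3 (clusters `C_s`)] -/
def rV (U : Finset V) (z : V) (ω : Set (Sym2 V)) : Set V :=
  {v | (openGraph (ω ∩ edgesIn U)).Reachable z v}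

/-- The **admissible family** of vertex sets attached to `(y, X, T)`: the sets meeting `X`
(*captures*) together with the members of `T` avoiding `y` (*free clusters of shape `T`*).
[folklore] -/
def admFam (y : V) (X : Set V) (T : Set (Set V)) : Set (Set V) :=
  {B | (∃ x ∈ X, x ∈ B) ∨ (B ∈ T ∧ y ∉ B)}

/-- The indicator of the **admissible event** `A(X) = {C_z meets X} ∪ {V(C_z) ∈ T, y ∉ V(C_z)}`
for percolation restricted to `U`. [folklore] -/
noncomputable def adm (U : Finset V) (z y : V) (X : Set V) (T : Set (Set V))
    (ω : Set (Sym2 V)) : ℝ :=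
  ind (admFam y X T) (rV U z ω)

/-- `z ∈ V(C_z)`. [folklore] -/
private theorem mem_rV_self (U : Finset V) (z : V) (ω : Set (Sym2 V)) : z ∈ rV U z ω :=
  SimpleGraph.Reachable.refl z

/-- The vertex cluster of `z` is increasing in the configuration ("such an event is increasing",
BHK p. 3). [cite: VandenbergHaggstromKahn2005, §1 p. 3] -/
theorem rV_mono {U : Finset V} {z : V} {ω ω' : Set (Sym2 V)} (h : ω ⊆ ω') :
    rV U z ω ⊆ rV U z ω' := fun _ hv =>
  SimpleGraph.Reachable.mono (openGraph_le (Set.inter_subset_inter_left _ h)) hv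

/-- The vertex cluster is increasing in the vertex set `U`. [folklore] -/
private theorem rV_mono_set {U U' : Finset V} (h : U' ⊆ U) (z : V) (ω : Set (Sym2 V)) :
    rV U' z ω ⊆ rV U z ω := fun _ hv =>
  SimpleGraph.Reachable.mono (openGraph_le (Set.inter_subset_inter_right _ (edgesIn_mono h))) hv

/-- The vertex cluster of `z ∈ U` stays inside `U`. [folklore] -/
private theorem rV_subset {U : Finset V} {z : V} (hz : z ∈ U) (ω : Set (Sym2 V)) : rV U z ω ⊆ ↑U := by
  intro v hv
  have hv' : (openGraph (ω ∩ edgesIn U)).Reachable z v := hv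
  rw [SimpleGraph.reachable_iff_reflTransGen] at hv'
  induction hv' with
  | refl => exact hz
  | tail _ hbc _ => exact (adj_iff.1 hbc).2.1.2

/-- `z` is captured by `X` iff `R_X(z)` fails. [folklore] -/
private theorem not_mem_rD_iff {U : Finset V} {z : V} {X : Set V} {ω : Set (Sym2 V)} :
    ω ∉ rD U z X ↔ ∃ x ∈ X, x ∈ rV U z ω := by
  simp only [rD, rV, Set.mem_setOf_eq, not_forall, not_not, exists_prop]

/-- On the event of `mem_rD_iff_restrict` (for `z`), the vertex cluster of `z` in `G[U]` is its
vertex cluster in `G[U ∖ Z]`. [cite: VandenbergHaggstromKahn2005, §1 p. 4, identity (6)] -/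
theorem rV_restrict {U Z : Finset V} {z : V} (hz : z ∉ Z) {ω : Set (Sym2 V)}
    (hS : ∀ n ∈ rS U Z ω, ¬ (openGraph (ω ∩ edgesIn (U \ Z))).Reachable z n) :
    rV U z ω = rV (U \ Z) z ω :=
  Set.Subset.antisymm (fun _ hv => (reach_restrict hz hS hv).2) (rV_mono_set Finset.sdiff_subset z ω)

/-- The vertex cluster in `G[U ∖ Z]` does not depend on the edges meeting `Z`. [folklore] -/
private theorem rV_diff_meeting (U Z : Finset V) (z : V) (ω : Set (Sym2 V)) :
    rV (U \ Z) z (ω \ meeting Z) = rV (U \ Z) z ω := by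
  simp only [rV, diff_meeting_inter_edgesIn]

/-- `0 ≤ 1_{A(X)}`. [folklore] -/
private theorem adm_nonneg (U : Finset V) (z y : V) (X : Set V) (T : Set (Set V)) (ω : Set (Sym2 V)) :
    0 ≤ adm U z y X T ω := ind_nonneg _ _

/-- `1_{A(X)} ≤ 1`. [folklore] -/
private theorem adm_le_one (U : Finset V) (z y : V) (X : Set V) (T : Set (Set V)) (ω : Set (Sym2 V)) :
    adm U z y X T ω ≤ 1 := ind_le_one _ _

/-- Captures are increasing in the capturing set. [folklore] -/
private theorem admFam_mono (y : V) {X X' : Set V} (h : X ⊆ X') (T : Set (Set V)) :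
    admFam y X T ⊆ admFam y X' T := fun _ hB =>
  hB.imp (fun ⟨x, hx, hxB⟩ => ⟨x, h hx, hxB⟩) id

/-- The admissible indicator is increasing in the capturing set `X` (the one fact beyond BHK's
proof that the induction uses). [folklore] -/
private theorem adm_mono (U : Finset V) (z y : V) {X X' : Set V} (h : X ⊆ X') (T : Set (Set V))
    (ω : Set (Sym2 V)) : adm U z y X T ω ≤ adm U z y X' T ω :=
  ind_mono (admFam_mono y h T) _

/-- If `z ∈ X` every configuration is a capture: `A(X) = Ω`. [folklore] -/
private theorem adm_eq_one {U : Finset V} {z : V} (y : V) {X : Set V} (hz : z ∈ X) (T : Set (Set V))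
    (ω : Set (Sym2 V)) : adm U z y X T ω = 1 :=
  ind_of_mem (Or.inl ⟨z, hz, mem_rV_self U z ω⟩)

/-- **BHK's identity (6) for admissible events**: for `Z ⊆ X` with `z ∉ Z`, the admissible event
of `G[U]` for `X` is the admissible event of `G[U ∖ Z]` for `(X ∖ Z) ∪ S(ω)`.
[cite: VandenbergHaggstromKahn2005, §1 p. 4, identity (6)] -/
theorem adm_restrict {U Z : Finset V} (hZU : Z ⊆ U) {z : V} (hz : z ∉ Z) (y : V) {X : Set V}
    (hZX : (↑Z : Set V) ⊆ X) (T : Set (Set V)) (ω : Set (Sym2 V)) :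
    adm U z y X T ω = adm (U \ Z) z y ((X \ ↑Z) ∪ rS U Z ω) T ω := by
  unfold adm
  by_cases hc : ω ∈ rD U z X
  · -- no capture in `G[U]`, hence none in `G[U ∖ Z]`, and the vertex clusters agree
    have hc' := (mem_rD_iff_restrict hZU hz hZX ω).1 hc
    have hS : ∀ n ∈ rS U Z ω, ¬ (openGraph (ω ∩ edgesIn (U \ Z))).Reachable z n :=
      fun n hn => hc' n (Or.inr hn)
    have hV : rV U z ω = rV (U \ Z) z ω := rV_restrict hz hS
    have h1 : ¬ ∃ x ∈ X, x ∈ rV U z ω := fun h => not_mem_rD_iff.2 h hc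
    have h2 : ¬ ∃ x ∈ (X \ ↑Z) ∪ rS U Z ω, x ∈ rV (U \ Z) z ω := fun h => not_mem_rD_iff.2 h hc'
    rw [hV] at h1
    rw [← hV]
    by_cases hf : rV U z ω ∈ T ∧ y ∉ rV U z ω
    · rw [ind_of_mem (show rV U z ω ∈ admFam y X T from Or.inr hf),
        ind_of_mem (show rV U z ω ∈ admFam y ((X \ ↑Z) ∪ rS U Z ω) T from Or.inr hf)]
    · rw [hV] at hf ⊢
      rw [ind_of_not_mem (show rV (U \ Z) z ω ∉ admFam y X T from fun h => h.elim h1 hf),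
        ind_of_not_mem (show rV (U \ Z) z ω ∉ admFam y ((X \ ↑Z) ∪ rS U Z ω) T from
          fun h => h.elim h2 hf)]
  · rw [ind_of_mem (show rV U z ω ∈ admFam y X T from Or.inl (not_mem_rD_iff.1 hc)),
      ind_of_mem (show rV (U \ Z) z ω ∈ admFam y ((X \ ↑Z) ∪ rS U Z ω) T from
        Or.inl (not_mem_rD_iff.1 fun h => hc ((mem_rD_iff_restrict hZU hz hZX ω).2 h)))]

/-! ### The cylinder `{V(C_z) = B}`: locality and the Markov property of the explored cluster -/

/-- If the vertex cluster of `z` computed with the edges meeting `B` only is inside `B`, then every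
open path from `z` uses edges meeting `B` only. [folklore] -/
private theorem reach_inter_meeting {U B : Finset V} {z : V} {ω : Set (Sym2 V)}
    (hB : rV U z (ω ∩ meeting B) ⊆ ↑B) {v : V}
    (hv : (openGraph (ω ∩ edgesIn U)).Reachable z v) :
    (openGraph ((ω ∩ meeting B) ∩ edgesIn U)).Reachable z v := by
  rw [SimpleGraph.reachable_iff_reflTransGen] at hv
  induction hv with
  | refl => exact SimpleGraph.Reachable.refl z
  | tail _ hbc ih =>
    obtain ⟨hω, hU, hne⟩ := adj_iff.1 hbc
    have hb : _ ∈ B := hB ih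
    exact ih.trans (SimpleGraph.Adj.reachable
      (adj_iff.2 ⟨⟨hω, _, hb, Sym2.mem_mk_left _ _⟩, hU, hne⟩))

/-- The cylinder `{V(C_z) = B}` is determined by the edges meeting `B`. [folklore] -/
private theorem rV_eq_iff_inter_meeting (U B : Finset V) (z : V) (ω : Set (Sym2 V)) :
    rV U z ω = ↑B ↔ rV U z (ω ∩ meeting B) = ↑B := by
  have hmono : rV U z (ω ∩ meeting B) ⊆ rV U z ω := rV_mono Set.inter_subset_left
  constructor
  · intro h
    refine Set.Subset.antisymm (hmono.trans h.subset) fun v hv => ?_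
    have hv' : v ∈ rV U z ω := h.symm ▸ hv
    exact reach_inter_meeting (hmono.trans h.subset) hv'
  · intro h
    refine Set.Subset.antisymm (fun v hv => ?_) (h.symm ▸ hmono)
    exact h ▸ (reach_inter_meeting h.subset hv : v ∈ rV U z (ω ∩ meeting B))

/-- On `{V(C_z) = B}` no vertex outside `B` has an open edge into `B`: BHK's `S` for `Z = B` is
empty. [folklore] -/
private theorem rS_eq_empty_of_rV_eq {U B : Finset V} {z : V} (hz : z ∈ U) {ω : Set (Sym2 V)}
    (h : rV U z ω = ↑B) : rS U B ω = ∅ := by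
  refine Set.eq_empty_of_forall_notMem fun n ⟨hn, b, hb, hnb⟩ => ?_
  obtain ⟨hnU, hnB⟩ := Finset.mem_sdiff.1 hn
  have hbV : b ∈ rV U z ω := by rw [h]; exact hb
  have hbU : b ∈ U := rV_subset hz ω hbV
  have hnV : n ∈ rV U z ω := by
    refine SimpleGraph.Reachable.trans hbV (SimpleGraph.Adj.reachable (adj_iff.2 ⟨?_, ⟨hbU, hnU⟩, ?_⟩))
    · rw [Sym2.eq_swap]; exact hnb
    · rintro rfl; exact hnB hb
  rw [h] at hnV
  exact hnB hnV

/-- On `{V(C_z) = B}` with `y ∉ B`, `y` is joined to no vertex of `B`. [folklore] -/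
private theorem mem_rD_of_rV_eq {U B : Finset V} {z y : V} {ω : Set (Sym2 V)} (h : rV U z ω = ↑B)
    (hy : y ∉ B) : ω ∈ rD U y ↑B := by
  intro b hb hyb
  have hbz : b ∈ rV U z ω := by rw [h]; exact hb
  have : y ∈ rV U z ω := SimpleGraph.Reachable.trans hbz hyb.symm
  rw [h] at this
  exact hy this

/-- **Markov property of the explored cluster**, pointwise: on `{V(C_z) = B}` with `y ∉ B`, the
events `R_W(y)` and the cluster `C_y` of `G[U]` are those of `G[U ∖ B]` (for `W ∖ B`).
[cite: VandenbergHaggstromKahn2005, §1 p. 4, identity (6) with `Z = B`, `S = ∅`] -/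
theorem restrict_on_cyl {U B : Finset V} (hBU : B ⊆ U) {z y : V} (hz : z ∈ U) (hy : y ∉ B)
    {ω : Set (Sym2 V)} (h : rV U z ω = ↑B) (W : Set V) :
    (ω ∈ rD U y W ↔ ω ∈ rD (U \ B) y (W \ ↑B)) ∧ rC U y ω = rC (U \ B) y ω := by
  have hS0 := rS_eq_empty_of_rV_eq hz h
  have hS : ∀ n ∈ rS U B ω, ¬ (openGraph (ω ∩ edgesIn (U \ B))).Reachable y n := by
    rw [hS0]; exact fun n hn => hn.elim
  refine ⟨?_, rC_restrict hy hS⟩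
  have key := mem_rD_iff_restrict hBU hy (W := W ∪ ↑B) Set.subset_union_right ω
  rw [hS0, Set.union_empty, Set.union_sdiff_right] at key
  rw [← key, rD_union]
  exact ⟨fun hW => ⟨hW, mem_rD_of_rV_eq h hy⟩, fun hW => hW.1⟩

/-- The admissible indicator of `G[U ∖ Z]` does not depend on the edges meeting `Z`. [folklore] -/
private theorem adm_diff_meeting (U Z : Finset V) (z y : V) (X : Set V) (T : Set (Set V))
    (ω : Set (Sym2 V)) : adm (U \ Z) z y X T (ω \ meeting Z) = adm (U \ Z) z y X T ω := by
  unfold adm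
  rw [rV_diff_meeting]

/-- The restricted cluster is increasing in the vertex set `U`. [folklore] -/
private theorem rC_mono_set {U U' : Finset V} (h : U' ⊆ U) (s : V) (ω : Set (Sym2 V)) :
    rC U' s ω ⊆ rC U s ω :=
  openEdgeCluster_mono (Set.inter_subset_inter_right _ (edgesIn_mono h)) s

/-- `R_W` in `G[U]` implies `R_{W'}` in `G[U']` for `U' ⊆ U`, `W' ⊆ W` (monotone coupling).
[folklore] -/
private theorem rD_subset_restrict {U U' : Finset V} (h : U' ⊆ U) (s : V) {W W' : Set V} (hW : W' ⊆ W) :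
    rD U s W ⊆ rD U' s W' := fun _ hω x hx hr =>
  hω x (hW hx) (hr.mono (openGraph_le (Set.inter_subset_inter_right _ (edgesIn_mono h))))

/-- The indicator of the cylinder `{V(C_z) = B}` (restricted to `U`). [folklore] -/
noncomputable def cyl (U : Finset V) (z : V) (B : Finset V) (ω : Set (Sym2 V)) : ℝ :=
  if rV U z ω = ↑B then 1 else 0

/-- `0 ≤ 1_{V(C_z) = B}`. [folklore] -/
private theorem cyl_nonneg (U : Finset V) (z : V) (B : Finset V) (ω : Set (Sym2 V)) : 0 ≤ cyl U z B ω := by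
  unfold cyl; split_ifs <;> norm_num

/-- On the cylinder `{V(C_z) = B}` the admissible indicator is the constant `1_𝒜(B)`. [folklore] -/
private theorem cyl_mul_adm (U B : Finset V) (z y : V) (X : Set V) (T : Set (Set V)) (ω : Set (Sym2 V)) :
    cyl U z B ω * adm U z y X T ω = cyl U z B ω * ind (admFam y X T) (↑B : Set V) := by
  unfold cyl
  by_cases hB : rV U z ω = ↑B
  · rw [if_pos hB, adm, hB]
  · rw [if_neg hB, zero_mul, zero_mul]

/-- Outside `U` there are no cylinders: `1_{V(C_z) = B} = 0` unless `B ⊆ U`. [folklore] -/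
private theorem cyl_eq_zero {U B : Finset V} {z : V} (hz : z ∈ U) (hBU : ¬ B ⊆ U) (ω : Set (Sym2 V)) :
    cyl U z B ω = 0 := by
  unfold cyl
  rw [if_neg]
  intro h
  exact hBU fun b hb => rV_subset hz ω (by rw [h]; exact hb)

variable [Fintype V]

/-- `Σ_B 1_{V(C_z) = B} = 1`. [folklore] -/
private theorem sum_cyl (U : Finset V) (z : V) (ω : Set (Sym2 V)) : ∑ B : Finset V, cyl U z B ω = 1 := by
  have key : ∀ B : Finset V, cyl U z B ω = if B = (rV U z ω).toFinset then 1 else 0 := fun B => by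
    unfold cyl
    by_cases hB : rV U z ω = ↑B
    · rw [if_pos hB, if_pos]
      rw [← Finset.coe_inj, Set.coe_toFinset, hB]
    · rw [if_neg hB, if_neg]
      intro h
      exact hB (by rw [h, Set.coe_toFinset])
  simp_rw [key]
  rw [Finset.sum_ite_eq' Finset.univ, if_pos (Finset.mem_univ _)]

/-- **Markov property of the explored cluster, summed** (the base case of the induction): on the
cylinder `{V(C_z) = B}`, `y ∉ B`, the law of the cluster functionals of `y` is that of percolation
on `G[U ∖ B]`.  [cite: VandenbergHaggstromKahn2005, §1 p. 4, identity (6) (with `Z = B`, `S = ∅`)] -/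
theorem cond_cluster {U B : Finset V} (hBU : B ⊆ U) {z y : V} (hz : z ∈ U) (hy : y ∉ B)
    (w : Sym2 V → ℝ) (hm : ∑ ω, weight w ω = 1) (h : Set (Sym2 V) → ℝ) (W : Set V) :
    ∑ ω, weight w ω * (cyl U z B ω * (h (rC U y ω) * ind (rD U y W) ω)) =
      ∑ ω, weight w ω * (cyl U z B ω *
        ∑ η, weight w η * (h (rC (U \ B) y η) * ind (rD (U \ B) y (W \ ↑B)) η)) := by
  set A := meeting B with hA
  set Ψ : Set (Sym2 V) → ℝ := fun η =>
    h (rC (U \ B) y η) * ind (rD (U \ B) y (W \ ↑B)) η with hΨ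
  set Φ : Set (Sym2 V) → Set (Sym2 V) → ℝ := fun ζ η => cyl U z B ζ * Ψ η with hΦ
  have hcyl : ∀ ω, cyl U z B (ω ∩ A) = cyl U z B ω := fun ω => by
    simp only [cyl, hA, ← rV_eq_iff_inter_meeting]
  have hΨA : ∀ η, Ψ (η \ A) = Ψ η := fun η => by
    simp only [hΨ, hA, rC_diff_meeting]
    by_cases hη : η ∈ rD (U \ B) y (W \ ↑B)
    · rw [ind_of_mem hη, ind_of_mem ((mem_rD_diff_meeting U B y _ η).2 hη)]
    · rw [ind_of_not_mem hη, ind_of_not_mem fun h' => hη ((mem_rD_diff_meeting U B y _ η).1 h')]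
  have h1 : ∀ ω, cyl U z B ω * (h (rC U y ω) * ind (rD U y W) ω) = Φ (ω ∩ A) (ω \ A) := by
    intro ω
    simp only [hΦ]
    rw [hcyl, hΨA]
    by_cases hB : rV U z ω = ↑B
    · obtain ⟨hDW, hC⟩ := restrict_on_cyl hBU hz hy hB W
      simp only [hΨ]
      rw [hC]
      by_cases hω : ω ∈ rD U y W
      · rw [ind_of_mem hω, ind_of_mem (hDW.1 hω)]
      · rw [ind_of_not_mem hω, ind_of_not_mem fun h' => hω (hDW.2 h')]
    · simp only [cyl, if_neg hB, zero_mul]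
  have h2 : ∀ ω ω', Φ (ω ∩ A) (ω' \ A) = cyl U z B ω * Ψ ω' := fun ω ω' => by
    simp only [hΦ]
    rw [hcyl, hΨA]
  calc ∑ ω, weight w ω * (cyl U z B ω * (h (rC U y ω) * ind (rD U y W) ω))
      = (∑ ω, weight w ω) * ∑ ω, weight w ω * Φ (ω ∩ A) (ω \ A) := by
        rw [hm, one_mul]; simp_rw [h1]
    _ = ∑ ω, weight w ω * ∑ ω', weight w ω' * Φ (ω ∩ A) (ω' \ A) := blockFubini w A Φ
    _ = ∑ ω, weight w ω * (cyl U z B ω * ∑ η, weight w η * Ψ η) := by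
        have h3 : ∀ ω, ∑ ω', weight w ω' * (cyl U z B ω * Ψ ω') =
            cyl U z B ω * ∑ η, weight w η * Ψ η := fun ω => by
          rw [Finset.mul_sum]
          exact Finset.sum_congr rfl fun η _ => by ring
        simp_rw [h2, h3]

/-- `cond_cluster` for the event `R_W` alone. [cite: VandenbergHaggstromKahn2005, §1 p. 4, identity (6)] -/
theorem cond_cluster_one {U B : Finset V} (hBU : B ⊆ U) {z y : V} (hz : z ∈ U) (hy : y ∉ B)
    (w : Sym2 V → ℝ) (hm : ∑ ω, weight w ω = 1) (W : Set V) :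
    ∑ ω, weight w ω * (cyl U z B ω * ind (rD U y W) ω) =
      ∑ ω, weight w ω * (cyl U z B ω * ∑ η, weight w η * ind (rD (U \ B) y (W \ ↑B)) η) := by
  have := cond_cluster hBU hz hy w hm (fun _ => 1) W
  simpa only [one_mul] using this

/-! ### The base case `X ∩ Y = ∅`: decomposition by the vertex cluster of `z` -/

/-- **Base case of the induction.**  For any `X, Y` (used when `X ∩ Y = ∅`):
`E[1_A 1_{R_X}] · E[h(C_y) 1_{R_Y}] ≤ E[1_A h(C_y) 1_{R_{X ∪ Y}}]`, by decomposing according to the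
vertex cluster `B` of `z`: on `{V(C_z) = B}` (`y ∉ B`) the `y`-functionals are those of percolation
on `G[U ∖ B]` (`cond_cluster`), where `1_{R_{X∖B}}` and `h(C_y) 1_{R_{Y∖B}}` are decreasing, hence
positively correlated (Harris), and dominate `1_{R_X}`, `h(C_y) 1_{R_Y}` of `G[U]`.
[cite: VandenbergHaggstromKahn2005, §1 p. 4 (display (4), Harris) and identity (6)] -/
theorem base_adm (w : Sym2 V → ℝ) (hw0 : ∀ e, 0 ≤ w e) (hw1 : ∀ e, w e ≤ 1)
    (hm : ∑ ω, weight w ω = 1) {U : Finset V} {z : V} (hz : z ∈ U) (y : V)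
    (X Y : Set V) (T : Set (Set V)) {h : Set (Sym2 V) → ℝ} (hh : Antitone h)
    (hh0 : ∀ a, 0 ≤ h a) :
    (∑ ω, weight w ω * (adm U z y X T ω * ind (rD U y X) ω)) *
      (∑ ω, weight w ω * (h (rC U y ω) * ind (rD U y Y) ω)) ≤
    ∑ ω, weight w ω * (adm U z y X T ω * (h (rC U y ω) * ind (rD U y (X ∪ Y)) ω)) := by
  set Q := ∑ ω, weight w ω * (h (rC U y ω) * ind (rD U y Y) ω) with hQ
  have hQ0 : 0 ≤ Q := sum_ind_nonneg hw0 hw1 (fun _ => hh0 _) _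
  -- decompose according to the vertex cluster `B` of `z`
  have hdec : ∀ F : Set (Sym2 V) → ℝ, ∑ ω, weight w ω * (adm U z y X T ω * F ω) =
      ∑ B : Finset V, ind (admFam y X T) ↑B * ∑ ω, weight w ω * (cyl U z B ω * F ω) := by
    intro F
    have e : ∀ ω, weight w ω * (adm U z y X T ω * F ω) =
        ∑ B : Finset V, ind (admFam y X T) ↑B * (weight w ω * (cyl U z B ω * F ω)) := by
      intro ω
      have e' : ∀ B : Finset V, ind (admFam y X T) ↑B * (weight w ω * (cyl U z B ω * F ω)) =
          (cyl U z B ω * adm U z y X T ω) * (weight w ω * F ω) := fun B => by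
        rw [cyl_mul_adm]; ring
      simp_rw [e', ← Finset.sum_mul, sum_cyl]
      ring
    simp_rw [e]
    rw [Finset.sum_comm]
    simp_rw [Finset.mul_sum]
  rw [hdec (fun ω => ind (rD U y X) ω), hdec, Finset.sum_mul]
  refine Finset.sum_le_sum fun B _ => ?_
  -- the claim for a fixed vertex cluster `B`
  by_cases hα : (↑B : Set V) ∈ admFam y X T
  swap
  · rw [ind_of_not_mem hα, zero_mul, zero_mul, zero_mul]
  rw [ind_of_mem hα, one_mul, one_mul]
  have hR0 : 0 ≤ ∑ ω, weight w ω * (cyl U z B ω * (h (rC U y ω) * ind (rD U y (X ∪ Y)) ω)) :=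
    Finset.sum_nonneg fun ω _ => mul_nonneg (weight_nonneg hw0 hw1 ω)
      (mul_nonneg (cyl_nonneg _ _ _ _) (mul_nonneg (hh0 _) (ind_nonneg _ _)))
  by_cases hyB : y ∈ B
  · -- `y ∈ B = V(C_z)` and `B` admissible force a capture `x ∈ B ∩ X`, so `y ↔ x`: `R_X` fails
    obtain ⟨x, hxX, hxB⟩ : ∃ x ∈ X, x ∈ (↑B : Set V) := hα.resolve_right fun h' => h'.2 hyB
    have h0 : ∑ ω, weight w ω * (cyl U z B ω * ind (rD U y X) ω) = 0 := by
      refine Finset.sum_eq_zero fun ω _ => ?_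
      by_cases hB : rV U z ω = ↑B
      · have hxr : x ∈ rV U z ω := by rw [hB]; exact hxB
        have hyr : y ∈ rV U z ω := by rw [hB]; exact hyB
        have : ω ∉ rD U y X := fun hω =>
          hω x hxX (SimpleGraph.Reachable.trans (SimpleGraph.Reachable.symm hyr) hxr)
        rw [ind_of_not_mem this, mul_zero, mul_zero]
      · rw [cyl, if_neg hB, zero_mul, mul_zero]
    rw [h0, zero_mul]
    exact hR0
  by_cases hBU : B ⊆ U
  swap
  · -- no such cylinder
    have h0 : ∀ F : Set (Sym2 V) → ℝ, ∑ ω, weight w ω * (cyl U z B ω * F ω) = 0 := fun F =>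
      Finset.sum_eq_zero fun ω _ => by rw [cyl_eq_zero hz hBU, zero_mul, mul_zero]
    rw [h0, h0 (fun ω => h (rC U y ω) * ind (rD U y (X ∪ Y)) ω), zero_mul]
  -- the main case `y ∉ B ⊆ U`: condition on the cylinder
  set PX := ∑ η, weight w η * ind (rD (U \ B) y (X \ ↑B)) η with hPX
  set QY := ∑ η, weight w η * (h (rC (U \ B) y η) * ind (rD (U \ B) y (Y \ ↑B)) η) with hQY
  set E := ∑ η, weight w η * (h (rC (U \ B) y η) * ind (rD (U \ B) y ((X ∪ Y) \ ↑B)) η) with hE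
  set PB := ∑ ω, weight w ω * cyl U z B ω with hPB
  have hPB0 : 0 ≤ PB := Finset.sum_nonneg fun ω _ =>
    mul_nonneg (weight_nonneg hw0 hw1 ω) (cyl_nonneg _ _ _ _)
  have hPX0 : 0 ≤ PX := Finset.sum_nonneg fun ω _ =>
    mul_nonneg (weight_nonneg hw0 hw1 ω) (ind_nonneg _ _)
  have eL : ∑ ω, weight w ω * (cyl U z B ω * ind (rD U y X) ω) = PB * PX := by
    rw [cond_cluster_one hBU hz hyB w hm X, hPB, Finset.sum_mul]
    exact Finset.sum_congr rfl fun ω _ => by ring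
  have eR : ∑ ω, weight w ω * (cyl U z B ω * (h (rC U y ω) * ind (rD U y (X ∪ Y)) ω)) =
      PB * E := by
    rw [cond_cluster hBU hz hyB w hm h (X ∪ Y), hPB, Finset.sum_mul]
    exact Finset.sum_congr rfl fun ω _ => by ring
  -- Harris in `G[U ∖ B]` for the decreasing `1_{R_{X∖B}}` and `h(C_y) 1_{R_{Y∖B}}`
  have hHarris : PX * QY ≤ E := by
    have hf : Antitone (ind (rD (U \ B) y (X \ ↑B))) := ind_rD_antitone _ _ _
    have hg : Antitone fun η => h (rC (U \ B) y η) * ind (rD (U \ B) y (Y \ ↑B)) η :=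
      fun a b hab => mul_le_mul (hh (rC_mono _ _ hab)) (ind_rD_antitone _ _ _ hab)
        (ind_nonneg _ _) (hh0 _)
    have key := harris_anti_anti hw0 hw1 hm hf hg (M := 1) (N := h ∅)
      (fun _ => ind_le_one _ _)
      (fun a => (mul_le_mul (hh (Set.empty_subset _)) (ind_le_one _ _) (ind_nonneg _ _)
        (hh0 _)).trans_eq (mul_one _))
    refine key.trans_eq (Finset.sum_congr rfl fun η _ => ?_)
    rw [Set.union_sdiff_distrib, rD_union, ind_inter]
    ring
  -- monotone coupling `G[U ∖ B] ≤ G[U]`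
  have hcouple : Q ≤ QY := by
    refine Finset.sum_le_sum fun η _ => mul_le_mul_of_nonneg_left ?_ (weight_nonneg hw0 hw1 η)
    exact mul_le_mul (hh (rC_mono_set Finset.sdiff_subset y η))
      (ind_mono (rD_subset_restrict Finset.sdiff_subset y Set.sdiff_subset) η)
      (ind_nonneg _ _) (hh0 _)
  rw [eL, eR, mul_assoc]
  refine mul_le_mul_of_nonneg_left ?_ hPB0
  exact (mul_le_mul_of_nonneg_left hcouple hPX0).trans hHarris

/-! ### The case `A = Ω`: Theorem 1.1 with a decreasing cluster functional -/

/-- **BHK's Theorems 1.1 and 1.2 combined, for a decreasing functional of `C_y`:**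
`P(R_X) · E[h(C_y) 1_{R_Y}] ≤ P(R_{X ∩ Y}) · E[h(C_y) 1_{R_{X ∪ Y}}]` for `h ≥ 0` antitone.
From `core` with `F = G = 1` (Theorem 1.1) and `core` with `X = Y` (Theorem 1.2) applied to
`h(∅) − h` and the increasing indicator that `C_y` touches `X`.
[cite: VandenbergHaggstromKahn2005, Thm. 1.1 (p. 3) and Thm. 1.2 (p. 5)] -/
theorem core_anti (w : Sym2 V → ℝ) (hw0 : ∀ e, 0 ≤ w e) (hw1 : ∀ e, w e ≤ 1)
    (hm : ∑ ω, weight w ω = 1) {U : Finset V} {y : V} (hy : y ∈ U) {X Y : Set V}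
    (hXU : X ⊆ ↑U) (hYU : Y ⊆ ↑U) {h : Set (Sym2 V) → ℝ} (hh : Antitone h)
    (hh0 : ∀ a, 0 ≤ h a) :
    (∑ ω, weight w ω * ind (rD U y X) ω) *
      (∑ ω, weight w ω * (h (rC U y ω) * ind (rD U y Y) ω)) ≤
    (∑ ω, weight w ω * ind (rD U y (X ∩ Y)) ω) *
      (∑ ω, weight w ω * (h (rC U y ω) * ind (rD U y (X ∪ Y)) ω)) := by
  have hRHS : 0 ≤ (∑ ω, weight w ω * ind (rD U y (X ∩ Y)) ω) *
      (∑ ω, weight w ω * (h (rC U y ω) * ind (rD U y (X ∪ Y)) ω)) :=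
    mul_nonneg (Finset.sum_nonneg fun ω _ => mul_nonneg (weight_nonneg hw0 hw1 ω)
      (ind_nonneg _ _)) (sum_ind_nonneg hw0 hw1 (fun _ => hh0 _) _)
  by_cases hyX : y ∈ X
  · have h0 : ∑ ω, weight w ω * ind (rD U y X) ω = 0 :=
      Finset.sum_eq_zero fun ω _ => by
        rw [rD_eq_empty hyX, ind_of_not_mem (Set.notMem_empty ω), mul_zero]
    rw [h0, zero_mul]; exact hRHS
  by_cases hyY : y ∈ Y
  · have h0 : ∑ ω, weight w ω * (h (rC U y ω) * ind (rD U y Y) ω) = 0 :=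
      Finset.sum_eq_zero fun ω _ => by
        rw [rD_eq_empty hyY, ind_of_not_mem (Set.notMem_empty ω)]; ring
    rw [h0, mul_zero]; exact hRHS
  -- Theorem 1.1: `P(R_X) P(R_Y) ≤ P(R_{X∩Y}) P(R_{X∪Y})`
  have P1 := core w hw0 hw1 hm U y hy X Y hXU hYU (fun _ => 1) (fun _ => 1) monotone_const
    monotone_const (fun _ => zero_le_one) (fun _ => zero_le_one)
  simp only [one_mul] at P1
  -- Theorem 1.2 on `R_Y` for `h(∅) - h` and the indicator that `C_y` touches `X`
  set t : Set (Sym2 V) → ℝ := fun C => if ∃ x ∈ X, ∃ e ∈ C, x ∈ e then 1 else 0 with ht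
  have ht_mono : Monotone t := by
    intro C C' hCC'
    simp only [ht]
    by_cases hC : ∃ x ∈ X, ∃ e ∈ C, x ∈ e
    · obtain ⟨x, hx, e, he, hxe⟩ := hC
      rw [if_pos ⟨x, hx, e, he, hxe⟩, if_pos ⟨x, hx, e, hCC' he, hxe⟩]
    · rw [if_neg hC]; split_ifs <;> norm_num
  have ht0 : ∀ C, 0 ≤ t C := fun C => by simp only [ht]; split_ifs <;> norm_num
  have ht_eq : ∀ ω, t (rC U y ω) = 1 - ind (rD U y X) ω := by
    intro ω
    simp only [ht]
    by_cases hω : ω ∈ rD U y X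
    · have : ¬ ∃ x ∈ X, ∃ e ∈ rC U y ω, x ∈ e := fun ⟨x, hx, e, he, hxe⟩ =>
        hω x hx (((mem_openEdgeCluster_iff _ _ _).1 he).2.2 x hxe)
      rw [if_neg this, ind_of_mem hω]; ring
    · obtain ⟨x, hx, hxr⟩ := not_mem_rD_iff.1 hω
      have hxy : x ≠ y := fun h' => hyX (h' ▸ hx)
      have : ∃ x ∈ X, ∃ e ∈ rC U y ω, x ∈ e := by
        rcases (reachable_iff_exists_mem_openEdgeCluster _ y x).1 hxr with hx' | ⟨e, he, hxe⟩
        · exact absurd hx' hxy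
        · exact ⟨x, hx, e, he, hxe⟩
      rw [if_pos this, ind_of_not_mem hω]; ring
  have P2 := core w hw0 hw1 hm U y hy Y Y hYU hYU (fun C => h ∅ - h C) t
    (fun a b hab => sub_le_sub_left (hh hab) _) ht_mono
    (fun a => sub_nonneg.2 (hh (Set.empty_subset a))) ht0
  rw [Set.inter_self, Set.union_self] at P2
  simp_rw [ht_eq] at P2
  -- expand
  set PX := ∑ ω, weight w ω * ind (rD U y X) ω with hPX
  set PY := ∑ ω, weight w ω * ind (rD U y Y) ω with hPY
  set PXnY := ∑ ω, weight w ω * ind (rD U y (X ∩ Y)) ω with hPXnY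
  set PXY := ∑ ω, weight w ω * ind (rD U y (X ∪ Y)) ω with hPXY
  set EhY := ∑ ω, weight w ω * (h (rC U y ω) * ind (rD U y Y) ω) with hEhY
  set EhXY := ∑ ω, weight w ω * (h (rC U y ω) * ind (rD U y (X ∪ Y)) ω) with hEhXY
  have hXuY : ∀ ω, ind (rD U y (X ∪ Y)) ω = ind (rD U y X) ω * ind (rD U y Y) ω := fun ω => by
    rw [rD_union, ind_inter]
  have x1 : ∑ ω, weight w ω * ((h ∅ - h (rC U y ω)) * ind (rD U y Y) ω) = h ∅ * PY - EhY := by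
    have := sum_affine w (fun ω => (h ∅ - h (rC U y ω)) * ind (rD U y Y) ω)
      (ind (rD U y Y)) (fun ω => h (rC U y ω) * ind (rD U y Y) ω) (ind (rD U y Y))
      (ind (rD U y Y)) (h ∅) (-1) 0 0 (fun ω => by ring)
    rw [this]; ring
  have x2 : ∑ ω, weight w ω * ((1 - ind (rD U y X) ω) * ind (rD U y Y) ω) = PY - PXY := by
    have := sum_affine w (fun ω => (1 - ind (rD U y X) ω) * ind (rD U y Y) ω)
      (ind (rD U y Y)) (ind (rD U y (X ∪ Y))) (ind (rD U y Y)) (ind (rD U y Y))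
      1 (-1) 0 0 (fun ω => by rw [hXuY]; ring)
    rw [this]; ring
  have x3 : ∑ ω, weight w ω * ((h ∅ - h (rC U y ω)) * (1 - ind (rD U y X) ω) *
      ind (rD U y Y) ω) = h ∅ * PY - h ∅ * PXY - EhY + EhXY := by
    have := sum_affine w
      (fun ω => (h ∅ - h (rC U y ω)) * (1 - ind (rD U y X) ω) * ind (rD U y Y) ω)
      (ind (rD U y Y)) (ind (rD U y (X ∪ Y))) (fun ω => h (rC U y ω) * ind (rD U y Y) ω)
      (fun ω => h (rC U y ω) * ind (rD U y (X ∪ Y)) ω) (h ∅) (-h ∅) (-1) 1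
      (fun ω => by rw [hXuY]; ring)
    rw [this]; ring
  rw [x1, x2, x3] at P2
  -- `P2 : (h∅ PY - EhY) (PY - PXY) ≤ (h∅ PY - h∅ PXY - EhY + EhXY) PY`, i.e.
  -- `EhY PXY ≤ EhXY PY` (conditional positive correlation of `h(C_y)` and `1_{R_X}` given `R_Y`)
  have P2' : EhY * PXY ≤ EhXY * PY := by nlinarith [P2]
  have hPY0 : 0 ≤ PY := Finset.sum_nonneg fun ω _ =>
    mul_nonneg (weight_nonneg hw0 hw1 ω) (ind_nonneg _ _)
  have hPXnY0 : 0 ≤ PXnY := Finset.sum_nonneg fun ω _ =>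
    mul_nonneg (weight_nonneg hw0 hw1 ω) (ind_nonneg _ _)
  have hEhY0 : 0 ≤ EhY := sum_ind_nonneg hw0 hw1 (fun _ => hh0 _) _
  have hEhYle : EhY ≤ h ∅ * PY := by
    rw [hPY, Finset.mul_sum]
    refine Finset.sum_le_sum fun ω _ => ?_
    have := mul_le_mul_of_nonneg_right (hh (Set.empty_subset (rC U y ω))) (ind_nonneg (rD U y Y) ω)
    nlinarith [weight_nonneg hw0 hw1 ω, this]
  rcases hPY0.eq_or_lt with hPY0' | hPYpos
  · -- `P(R_Y) = 0`: then `E[h 1_{R_Y}] = 0`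
    have hE0 : EhY = 0 := le_antisymm (by rw [← hPY0', mul_zero] at hEhYle; exact hEhYle) hEhY0
    rw [hE0, mul_zero]; exact hRHS
  · have A : PX * EhY * PY ≤ PXnY * EhXY * PY :=
      calc PX * EhY * PY = (PX * PY) * EhY := by ring
        _ ≤ (PXnY * PXY) * EhY := mul_le_mul_of_nonneg_right P1 hEhY0
        _ = PXnY * (EhY * PXY) := by ring
        _ ≤ PXnY * (EhXY * PY) := mul_le_mul_of_nonneg_left P2' hPXnY0
        _ = PXnY * EhXY * PY := by ring
    exact le_of_mul_le_mul_right A hPYpos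

/-! ### Conditioning on `S` with the admissible factor, and the induction -/

/-- The block expectation `S ↦ E'[1_{A'((X∖Z) ∪ S)} H(C_y) 1{y ↮ B ∪ S}]` of `G[U']`.
[cite: VandenbergHaggstromKahn2005, §1 p. 4 (`Pr(· | S)`)] -/
noncomputable def blockA (w : Sym2 V → ℝ) (U' : Finset V) (z y : V) (X' : Set V)
    (T : Set (Set V)) (H : Set (Sym2 V) → ℝ) (B S : Set V) : ℝ :=
  ∑ ω, weight w ω * (adm U' z y (X' ∪ S) T ω * (H (rC U' y ω) * ind (rD U' y (B ∪ S)) ω))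

/-- Block expectations of nonnegative functions are nonnegative. [folklore] -/
private theorem blockA_nonneg {w : Sym2 V → ℝ} (hw0 : ∀ e, 0 ≤ w e) (hw1 : ∀ e, w e ≤ 1)
    (U' : Finset V) (z y : V) (X' : Set V) (T : Set (Set V)) {H : Set (Sym2 V) → ℝ}
    (hH : ∀ a, 0 ≤ H a) (B S : Set V) : 0 ≤ blockA w U' z y X' T H B S :=
  Finset.sum_nonneg fun ω _ => mul_nonneg (weight_nonneg hw0 hw1 ω)
    (mul_nonneg (adm_nonneg _ _ _ _ _ _) (mul_nonneg (hH _) (ind_nonneg _ _)))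

/-- **BHK's (6) with the admissible factor**: for `Z ⊆ X`, `Z ⊆ W`, `z, y ∉ Z`,
`E[1_{A(X)} H(C_y^U) 1{y ↮ W}] = Σ_ω weight(ω) · E'[1_{A'((X∖Z) ∪ S(ω))} H(C_y^{U∖Z})
1{y ↮ (W∖Z) ∪ S(ω)}]`. [cite: VandenbergHaggstromKahn2005, §1 p. 4, identity (6)] -/
theorem step_sum_adm {U Z : Finset V} (hZU : Z ⊆ U) {z y : V} (hz : z ∉ Z) (hy : y ∉ Z)
    {X W : Set V} (hZX : (↑Z : Set V) ⊆ X) (hZW : (↑Z : Set V) ⊆ W) (T : Set (Set V))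
    (w : Sym2 V → ℝ) (hm : ∑ ω, weight w ω = 1) (H : Set (Sym2 V) → ℝ) :
    ∑ ω, weight w ω * (adm U z y X T ω * (H (rC U y ω) * ind (rD U y W) ω)) =
      ∑ ω, weight w ω * blockA w (U \ Z) z y (X \ ↑Z) T H (W \ ↑Z) (rS U Z ω) := by
  set A := meeting Z with hA
  set Φ : Set (Sym2 V) → Set (Sym2 V) → ℝ := fun ζ η =>
    adm (U \ Z) z y ((X \ ↑Z) ∪ rS U Z ζ) T η *
      (H (rC (U \ Z) y η) * ind (rD (U \ Z) y ((W \ ↑Z) ∪ rS U Z ζ)) η) with hΦ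
  have h1 : ∀ ω, adm U z y X T ω * (H (rC U y ω) * ind (rD U y W) ω) = Φ (ω ∩ A) (ω \ A) := by
    intro ω
    simp only [hΦ, hA, rS_inter_meeting, rC_diff_meeting, adm_diff_meeting]
    rw [← adm_restrict hZU hz y hZX T ω]
    congr 1
    by_cases hω : ω ∈ rD U y W
    · have hω' := (mem_rD_iff_restrict hZU hy hZW ω).1 hω
      rw [ind_of_mem hω, ind_of_mem ((mem_rD_diff_meeting U Z y _ ω).2 hω'),
        rC_restrict hy fun n hn => hω' n (Or.inr hn)]
    · have hω' : ω \ meeting Z ∉ rD (U \ Z) y ((W \ ↑Z) ∪ rS U Z ω) := fun h =>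
        hω ((mem_rD_iff_restrict hZU hy hZW ω).2 ((mem_rD_diff_meeting U Z y _ ω).1 h))
      rw [ind_of_not_mem hω, ind_of_not_mem hω', mul_zero, mul_zero]
  have h2 : ∀ ω ω', Φ (ω ∩ A) (ω' \ A) =
      adm (U \ Z) z y ((X \ ↑Z) ∪ rS U Z ω) T ω' *
        (H (rC (U \ Z) y ω') * ind (rD (U \ Z) y ((W \ ↑Z) ∪ rS U Z ω)) ω') := by
    intro ω ω'
    simp only [hΦ, hA, rS_inter_meeting, rC_diff_meeting, adm_diff_meeting]
    congr 1
    by_cases hω' : ω' ∈ rD (U \ Z) y ((W \ ↑Z) ∪ rS U Z ω)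
    · rw [ind_of_mem hω', ind_of_mem ((mem_rD_diff_meeting U Z y _ ω').2 hω')]
    · rw [ind_of_not_mem hω',
        ind_of_not_mem (fun h => hω' ((mem_rD_diff_meeting U Z y _ ω').1 h))]
  calc ∑ ω, weight w ω * (adm U z y X T ω * (H (rC U y ω) * ind (rD U y W) ω))
      = (∑ ω, weight w ω) * ∑ ω, weight w ω * Φ (ω ∩ A) (ω \ A) := by
        rw [hm, one_mul]; simp_rw [h1]
    _ = ∑ ω, weight w ω * ∑ ω', weight w ω' * Φ (ω ∩ A) (ω' \ A) := blockFubini w A Φ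
    _ = ∑ ω, weight w ω * blockA w (U \ Z) z y (X \ ↑Z) T H (W \ ↑Z) (rS U Z ω) := by
        simp_rw [h2]; rfl

/-- **The two-set inequality for admissible events, for percolation restricted to `U`.**  For
`y, z ∈ U`, `X, Y ⊆ U`, `T` a family of vertex sets and `h ≥ 0` antitone,
`E[1_{A(X)} 1_{R_X}] · E[h(C_y) 1_{R_Y}] ≤ P(R_{X ∩ Y}) · E[1_{A(X)} h(C_y) 1_{R_{X ∪ Y}}]`
(`R_W = {y ↮ W}`, `A(X) = {C_z meets X} ∪ {V(C_z) ∈ T, y ∉ V(C_z)}`).  Proof by strong induction on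
`U` following BHK's proof of their Theorem 1.1 verbatim (`z ∈ X`: `core_anti`; `X ∩ Y = ∅`:
`base_adm`; step: `step_sum`, `step_sum_adm`, the four functions theorem and the induction
hypothesis in `G[U ∖ Z]`, using that captures are increasing in the capturing set).
[cite: VandenbergHaggstromKahn2005, Thm. 1.1, proof pp. 3–5] -/
theorem adm_core (w : Sym2 V → ℝ) (hw0 : ∀ e, 0 ≤ w e) (hw1 : ∀ e, w e ≤ 1)
    (hm : ∑ ω, weight w ω = 1) (U : Finset V) :
    ∀ (y : V), y ∈ U → ∀ (z : V), z ∈ U → ∀ (X Y : Set V), X ⊆ ↑U → Y ⊆ ↑U →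
    ∀ (T : Set (Set V)) (h : Set (Sym2 V) → ℝ), Antitone h → (∀ a, 0 ≤ h a) →
    (∑ ω, weight w ω * (adm U z y X T ω * ind (rD U y X) ω)) *
      (∑ ω, weight w ω * (h (rC U y ω) * ind (rD U y Y) ω)) ≤
    (∑ ω, weight w ω * ind (rD U y (X ∩ Y)) ω) *
      (∑ ω, weight w ω * (adm U z y X T ω * (h (rC U y ω) * ind (rD U y (X ∪ Y)) ω))) := by
  induction U using Finset.strongInduction with
  | H U ih =>
  intro y hyU z hzU X Y hXU hYU T h hh hh0
  have hRHS : 0 ≤ (∑ ω, weight w ω * ind (rD U y (X ∩ Y)) ω) *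
      (∑ ω, weight w ω * (adm U z y X T ω * (h (rC U y ω) * ind (rD U y (X ∪ Y)) ω))) :=
    mul_nonneg (Finset.sum_nonneg fun ω _ => mul_nonneg (weight_nonneg hw0 hw1 ω)
      (ind_nonneg _ _)) (Finset.sum_nonneg fun ω _ => mul_nonneg (weight_nonneg hw0 hw1 ω)
      (mul_nonneg (adm_nonneg _ _ _ _ _ _) (mul_nonneg (hh0 _) (ind_nonneg _ _))))
  -- trivial cases `y ∈ X`, `y ∈ Y`
  by_cases hyX : y ∈ X
  · have h0 : ∑ ω, weight w ω * (adm U z y X T ω * ind (rD U y X) ω) = 0 :=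
      Finset.sum_eq_zero fun ω _ => by
        rw [rD_eq_empty hyX, ind_of_not_mem (Set.notMem_empty ω)]; ring
    rw [h0, zero_mul]; exact hRHS
  by_cases hyY : y ∈ Y
  · have h0 : ∑ ω, weight w ω * (h (rC U y ω) * ind (rD U y Y) ω) = 0 :=
      Finset.sum_eq_zero fun ω _ => by
        rw [rD_eq_empty hyY, ind_of_not_mem (Set.notMem_empty ω)]; ring
    rw [h0, mul_zero]; exact hRHS
  -- `z ∈ X`: `A(X) = Ω`, Theorems 1.1 and 1.2 for the decreasing `h`
  by_cases hzX : z ∈ X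
  · have e1 : ∀ ω, adm U z y X T ω = 1 := adm_eq_one y hzX T
    simp_rw [e1, one_mul]
    exact core_anti w hw0 hw1 hm hyU hXU hYU hh hh0
  -- `Z := X ∩ Y`
  set Z : Finset V := U.filter fun v => v ∈ X ∧ v ∈ Y with hZ
  have hZU : Z ⊆ U := Finset.filter_subset _ _
  have hmemZ : ∀ v, v ∈ Z ↔ v ∈ X ∧ v ∈ Y := fun v => by
    simp only [hZ, Finset.mem_filter, and_iff_right_iff_imp]
    exact fun h => hXU h.1
  have hyZ : y ∉ Z := fun h => hyX ((hmemZ y).1 h).1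
  have hzZ : z ∉ Z := fun h => hzX ((hmemZ z).1 h).1
  rcases Z.eq_empty_or_nonempty with hZe | hZne
  · /- `X ∩ Y = ∅`: decomposition by the vertex cluster of `z` and Harris (BHK display (4)). -/
    have hXY : ∀ ω, ind (rD U y (X ∩ Y)) ω = 1 := fun ω =>
      ind_of_mem fun x hx _ => by
        have : x ∈ Z := (hmemZ x).2 hx
        rw [hZe] at this
        exact absurd this (Finset.notMem_empty x)
    simp_rw [hXY, mul_one, hm, one_mul]
    exact base_adm w hw0 hw1 hm hzU y X Y T hh hh0
  · /- `Z ≠ ∅`: condition on `S` and apply the four functions theorem with the induction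
    hypothesis on `U ∖ Z` (BHK pp. 4–5). -/
    have hss : U \ Z ⊂ U := Finset.sdiff_ssubset hZU hZne
    have hyU' : y ∈ U \ Z := Finset.mem_sdiff.2 ⟨hyU, hyZ⟩
    have hzU' : z ∈ U \ Z := Finset.mem_sdiff.2 ⟨hzU, hzZ⟩
    have hZX : (↑Z : Set V) ⊆ X := fun v hv => ((hmemZ v).1 hv).1
    have hZY : (↑Z : Set V) ⊆ Y := fun v hv => ((hmemZ v).1 hv).2
    have hZXY : (↑Z : Set V) ⊆ X ∩ Y := fun v hv => (hmemZ v).1 hv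
    have hZXuY : (↑Z : Set V) ⊆ X ∪ Y := fun v hv => Or.inl (((hmemZ v).1 hv).1)
    -- the four sums, conditioned on `S`
    have e1 : ∑ ω, weight w ω * (adm U z y X T ω * ind (rD U y X) ω) =
        ∑ ω, weight w ω * blockA w (U \ Z) z y (X \ ↑Z) T (fun _ => 1) (X \ ↑Z) (rS U Z ω) := by
      have := step_sum_adm hZU hzZ hyZ hZX hZX T w hm (fun _ => 1)
      simpa only [one_mul] using this
    have e2 := step_sum hZU hyZ hZY w hm h
    have e3 : ∑ ω, weight w ω * ind (rD U y (X ∩ Y)) ω =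
        ∑ ω, weight w ω * blockE w (U \ Z) y (fun _ => 1) ((X ∩ Y) \ ↑Z) (rS U Z ω) := by
      have := step_sum hZU hyZ hZXY w hm (fun _ => 1)
      simpa only [one_mul] using this
    have e4 := step_sum_adm hZU hzZ hyZ hZX hZXuY T w hm h
    rw [e1, e2, e3, e4]
    refine four_functions_theorem_univ
      (fun ω => weight w ω * blockA w (U \ Z) z y (X \ ↑Z) T (fun _ => 1) (X \ ↑Z) (rS U Z ω))
      (fun ω => weight w ω * blockE w (U \ Z) y h (Y \ ↑Z) (rS U Z ω))
      (fun ω => weight w ω * blockE w (U \ Z) y (fun _ => 1) ((X ∩ Y) \ ↑Z) (rS U Z ω))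
      (fun ω => weight w ω * blockA w (U \ Z) z y (X \ ↑Z) T h ((X ∪ Y) \ ↑Z) (rS U Z ω))
      (fun ω => mul_nonneg (weight_nonneg hw0 hw1 ω)
        (blockA_nonneg hw0 hw1 _ _ _ _ _ (fun _ => zero_le_one) _ _))
      (fun ω => mul_nonneg (weight_nonneg hw0 hw1 ω) (blockE_nonneg hw0 hw1 _ _ hh0 _ _))
      (fun ω => mul_nonneg (weight_nonneg hw0 hw1 ω)
        (blockE_nonneg hw0 hw1 _ _ (fun _ => zero_le_one) _ _))
      (fun ω => mul_nonneg (weight_nonneg hw0 hw1 ω) (blockA_nonneg hw0 hw1 _ _ _ _ _ hh0 _ _))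
      fun a b => ?_
    -- the Ahlswede–Daykin hypothesis: weight lattice identity × induction hypothesis
    set Sa := rS U Z a with hSa
    set Sb := rS U Z b with hSb
    have hSaU : Sa ⊆ ↑(U \ Z) := rS_subset U Z a
    have hSbU : Sb ⊆ ↑(U \ Z) := rS_subset U Z b
    have hX1 : X \ ↑Z ∪ Sa ⊆ ↑(U \ Z) := Set.union_subset
      (fun v hv => by rw [Finset.coe_sdiff]; exact ⟨hXU hv.1, hv.2⟩) hSaU
    have hY1 : Y \ ↑Z ∪ Sb ⊆ ↑(U \ Z) := Set.union_subset
      (fun v hv => by rw [Finset.coe_sdiff]; exact ⟨hYU hv.1, hv.2⟩) hSbU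
    have IH := ih (U \ Z) hss y hyU' z hzU' (X \ ↑Z ∪ Sa) (Y \ ↑Z ∪ Sb) hX1 hY1 T h hh hh0
    -- monotonicity in the conditioning sets
    have hsub3 : (X ∩ Y) \ ↑Z ∪ rS U Z (a ∩ b) ⊆ (X \ ↑Z ∪ Sa) ∩ (Y \ ↑Z ∪ Sb) := by
      refine Set.union_subset (fun v hv => ⟨Or.inl ⟨hv.1.1, hv.2⟩, Or.inl ⟨hv.1.2, hv.2⟩⟩) ?_
      exact fun v hv =>
        ⟨Or.inr (rS_inter_subset U Z a b hv).1, Or.inr (rS_inter_subset U Z a b hv).2⟩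
    have hsub4 : (X ∪ Y) \ ↑Z ∪ rS U Z (a ∪ b) ⊆ (X \ ↑Z ∪ Sa) ∪ (Y \ ↑Z ∪ Sb) := by
      rw [rS_union]
      rintro v (⟨hXY | hXY, hvZ⟩ | hS | hS)
      · exact Or.inl (Or.inl ⟨hXY, hvZ⟩)
      · exact Or.inr (Or.inl ⟨hXY, hvZ⟩)
      · exact Or.inl (Or.inr hS)
      · exact Or.inr (Or.inr hS)
    have hsubX : X \ ↑Z ∪ Sa ⊆ X \ ↑Z ∪ rS U Z (a ∪ b) := by
      rw [rS_union]
      exact Set.union_subset_union_right _ Set.subset_union_left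
    have f1eq : blockA w (U \ Z) z y (X \ ↑Z) T (fun _ => 1) (X \ ↑Z) Sa =
        ∑ ω, weight w ω * (adm (U \ Z) z y (X \ ↑Z ∪ Sa) T ω *
          ind (rD (U \ Z) y (X \ ↑Z ∪ Sa)) ω) := by
      simp only [blockA, one_mul]
    have f2eq : blockE w (U \ Z) y h (Y \ ↑Z) Sb =
        ∑ ω, weight w ω * (h (rC (U \ Z) y ω) * ind (rD (U \ Z) y (Y \ ↑Z ∪ Sb)) ω) := rfl
    have h3 : ∑ ω, weight w ω * ind (rD (U \ Z) y ((X \ ↑Z ∪ Sa) ∩ (Y \ ↑Z ∪ Sb))) ω ≤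
        blockE w (U \ Z) y (fun _ => 1) ((X ∩ Y) \ ↑Z) (rS U Z (a ∩ b)) := by
      have := sum_ind_mono hw0 hw1 (h := fun _ => (1 : ℝ)) (fun _ => zero_le_one)
        (rD_antitone (U := U \ Z) (s := y) hsub3) (w := w)
      simp only [one_mul] at this
      simpa only [blockE, one_mul] using this
    have h4 : ∑ ω, weight w ω * (adm (U \ Z) z y (X \ ↑Z ∪ Sa) T ω * (h (rC (U \ Z) y ω) *
        ind (rD (U \ Z) y ((X \ ↑Z ∪ Sa) ∪ (Y \ ↑Z ∪ Sb))) ω)) ≤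
        blockA w (U \ Z) z y (X \ ↑Z) T h ((X ∪ Y) \ ↑Z) (rS U Z (a ∪ b)) := by
      refine Finset.sum_le_sum fun ω _ => mul_le_mul_of_nonneg_left ?_ (weight_nonneg hw0 hw1 ω)
      exact mul_le_mul (adm_mono _ _ _ hsubX _ _)
        (mul_le_mul_of_nonneg_left (ind_mono (rD_antitone hsub4) ω) (hh0 _))
        (mul_nonneg (hh0 _) (ind_nonneg _ _)) (adm_nonneg _ _ _ _ _ _)
    have hn4 : 0 ≤ ∑ ω, weight w ω * (adm (U \ Z) z y (X \ ↑Z ∪ Sa) T ω *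
        (h (rC (U \ Z) y ω) * ind (rD (U \ Z) y ((X \ ↑Z ∪ Sa) ∪ (Y \ ↑Z ∪ Sb))) ω)) :=
      Finset.sum_nonneg fun ω _ => mul_nonneg (weight_nonneg hw0 hw1 ω)
        (mul_nonneg (adm_nonneg _ _ _ _ _ _) (mul_nonneg (hh0 _) (ind_nonneg _ _)))
    have hIH' : blockA w (U \ Z) z y (X \ ↑Z) T (fun _ => 1) (X \ ↑Z) Sa *
        blockE w (U \ Z) y h (Y \ ↑Z) Sb ≤
        blockE w (U \ Z) y (fun _ => 1) ((X ∩ Y) \ ↑Z) (rS U Z (a ∩ b)) *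
          blockA w (U \ Z) z y (X \ ↑Z) T h ((X ∪ Y) \ ↑Z) (rS U Z (a ∪ b)) := by
      rw [f1eq, f2eq]
      exact IH.trans (mul_le_mul h3 h4 hn4 (blockE_nonneg hw0 hw1 _ _ (fun _ => zero_le_one) _ _))
    have hwab := weight_inter_mul_union w a b
    show weight w a * blockA w (U \ Z) z y (X \ ↑Z) T (fun _ => 1) (X \ ↑Z) Sa *
        (weight w b * blockE w (U \ Z) y h (Y \ ↑Z) Sb) ≤
      weight w (a ∩ b) * blockE w (U \ Z) y (fun _ => 1) ((X ∩ Y) \ ↑Z) (rS U Z (a ∩ b)) *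
        (weight w (a ∪ b) * blockA w (U \ Z) z y (X \ ↑Z) T h ((X ∪ Y) \ ↑Z) (rS U Z (a ∪ b)))
    calc weight w a * blockA w (U \ Z) z y (X \ ↑Z) T (fun _ => 1) (X \ ↑Z) Sa *
          (weight w b * blockE w (U \ Z) y h (Y \ ↑Z) Sb)
        = (weight w a * weight w b) *
          (blockA w (U \ Z) z y (X \ ↑Z) T (fun _ => 1) (X \ ↑Z) Sa *
            blockE w (U \ Z) y h (Y \ ↑Z) Sb) := by ring
      _ ≤ (weight w (a ∩ b) * weight w (a ∪ b)) *
          (blockE w (U \ Z) y (fun _ => 1) ((X ∩ Y) \ ↑Z) (rS U Z (a ∩ b)) *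
            blockA w (U \ Z) z y (X \ ↑Z) T h ((X ∪ Y) \ ↑Z) (rS U Z (a ∪ b))) := by
          rw [hwab]
          exact mul_le_mul_of_nonneg_left hIH'
            (mul_nonneg (weight_nonneg hw0 hw1 _) (weight_nonneg hw0 hw1 _))
      _ = _ := by ring

end Graph

end BHK2006

/-! ### Measure-level statements for `prodBernoulli w` on a finite graph -/

section Measure

variable {V : Type*}

/-- The **admissible event** `A(X) = {z ↔ X} ∪ {C(z) ∈ T, z ↮ y}` of the marker `z` relative to
the observer `y`: `z` is captured by `X`, or the vertex cluster of `z` is a member of the prescribed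
family `T` not containing `y`. [folklore] -/
def admissibleEvent (z y : V) (X : Set V) (T : Set (Set V)) : Set (BondConfig V) :=
  {ω | (∃ x ∈ X, (openGraph ω).Reachable z x) ∨
    (openCluster ω z ∈ T ∧ ¬ (openGraph ω).Reachable z y)}

variable [Fintype V]

open BHK2006 DecisionTree in
/-- **Two-set correlation inequality for admissible events** (van den Berg–Häggström–Kahn's
Theorem 1.1, admissible/decreasing form).  For independent bond percolation `prodBernoulli w` on
the finite vertex type `V`, vertices `z, y`, sets `X, Y ⊆ V`, a family `T` of vertex sets and an
antitone `F ≥ 0` of the open edge cluster `C_y`: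
`P(A(X) ∩ R_X) · E[F(C_y); R_Y] ≤ P(R_{X ∩ Y}) · E[1_{A(X)} F(C_y); R_{X ∪ Y}]`,
where `R_W = {y ↮ W}` and `A(X) = admissibleEvent z y X T`.
[cite: VandenbergHaggstromKahn2005, Thm. 1.1, proof pp. 3–5 (the induction, run for this form)] -/
theorem admissible_twoSet (w : Sym2 V → unitInterval) (z y : V) (X Y : Set V)
    (T : Set (Set V)) (F : Set (Sym2 V) → ℝ) (hF : Antitone F) (hF0 : ∀ a, 0 ≤ F a) :
    (prodBernoulli w).real
        (admissibleEvent z y X T ∩ {ω | ∀ x ∈ X, ¬ (openGraph ω).Reachable y x}) *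
      (∫ ω in {ω : BondConfig V | ∀ x ∈ Y, ¬ (openGraph ω).Reachable y x},
        F (openEdgeCluster ω y) ∂(prodBernoulli w)) ≤
    (prodBernoulli w).real {ω : BondConfig V | ∀ x ∈ X ∩ Y, ¬ (openGraph ω).Reachable y x} *
      ∫ ω in admissibleEvent z y X T ∩ {ω | ∀ x ∈ X ∪ Y, ¬ (openGraph ω).Reachable y x},
        F (openEdgeCluster ω y) ∂(prodBernoulli w) := by
  classical
  set w' : Sym2 V → ℝ := fun e => (w e : ℝ) with hw'
  have hw0 : ∀ e, 0 ≤ w' e := fun e => (w e).2.1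
  have hw1 : ∀ e, w' e ≤ 1 := fun e => (w e).2.2
  -- integrals and probabilities as finite sums
  have hint : ∀ (D : Set (BondConfig V)) (g : BondConfig V → ℝ),
      ∫ ω in D, g ω ∂(prodBernoulli w) = ∑ ω, weight w' ω * (g ω * ind D ω) := by
    intro D g
    rw [← integral_indicator MeasurableSet.of_discrete, integral_prodBernoulli_eq_sum]
    refine Finset.sum_congr rfl fun ω _ => ?_
    by_cases hω : ω ∈ D
    · rw [Set.indicator_of_mem hω, ind_of_mem hω, mul_one]
    · rw [Set.indicator_of_notMem hω, ind_of_not_mem hω]; ring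
  have hreal : ∀ D : Set (BondConfig V), (prodBernoulli w).real D = ∑ ω, weight w' ω * ind D ω := by
    intro D
    rw [← integral_indicator_one MeasurableSet.of_discrete, integral_prodBernoulli_eq_sum]
    refine Finset.sum_congr rfl fun ω _ => ?_
    by_cases hω : ω ∈ D
    · rw [Set.indicator_of_mem hω, ind_of_mem hω, Pi.one_apply]
    · rw [Set.indicator_of_notMem hω, ind_of_not_mem hω, mul_zero]
  have hm : ∑ ω, weight w' ω = 1 := by
    have h1 := integral_prodBernoulli_eq_sum w fun _ => (1 : ℝ)
    simp only [integral_const, probReal_univ, smul_eq_mul, mul_one] at h1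
    exact h1.symm
  -- `U = univ`: the restricted quantities are the original ones
  have hE : ∀ ω : Set (Sym2 V), ω ∩ edgesIn (Finset.univ : Finset V) = ω := fun ω => by
    ext e
    simp only [Set.mem_inter_iff, edgesIn, Set.mem_setOf_eq, Finset.mem_univ, imp_true_iff,
      and_true]
  have hC : ∀ ω, rC Finset.univ y ω = openEdgeCluster ω y := fun ω => by
    simp only [rC, hE]
  have hD : ∀ W : Set V, rD Finset.univ y W = {ω | ∀ x ∈ W, ¬ (openGraph ω).Reachable y x} :=
    fun W => by
      ext ω
      simp only [rD, hE, Set.mem_setOf_eq]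
  have hV : ∀ ω, rV Finset.univ z ω = openCluster ω z := fun ω => by
    ext v
    simp only [rV, hE, openCluster, Set.mem_setOf_eq]
  have hA : ∀ ω, adm Finset.univ z y X T ω = ind (admissibleEvent z y X T) ω := by
    intro ω
    have hiff : rV Finset.univ z ω ∈ admFam y X T ↔ ω ∈ admissibleEvent z y X T := by
      rw [hV]; exact Iff.rfl
    by_cases hω : ω ∈ admissibleEvent z y X T
    · rw [ind_of_mem hω, adm, ind_of_mem (hiff.2 hω)]
    · rw [ind_of_not_mem hω, adm, ind_of_not_mem fun h' => hω (hiff.1 h')]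
  have key := adm_core w' hw0 hw1 hm Finset.univ y (Finset.mem_univ y) z (Finset.mem_univ z) X Y
    (by simp) (by simp) T F hF hF0
  simp only [hC, hD, hA] at key
  rw [hreal, hint, hreal, hint]
  have r1 : ∑ ω, weight w' ω * ind (admissibleEvent z y X T ∩
      {ω | ∀ x ∈ X, ¬ (openGraph ω).Reachable y x}) ω = ∑ ω, weight w' ω *
      (ind (admissibleEvent z y X T) ω * ind {ω | ∀ x ∈ X, ¬ (openGraph ω).Reachable y x} ω) :=
    Finset.sum_congr rfl fun ω _ => by rw [ind_inter]
  have r4 : ∑ ω, weight w' ω * (F (openEdgeCluster ω y) * ind (admissibleEvent z y X T ∩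
      {ω | ∀ x ∈ X ∪ Y, ¬ (openGraph ω).Reachable y x}) ω) = ∑ ω, weight w' ω *
      (ind (admissibleEvent z y X T) ω * (F (openEdgeCluster ω y) *
        ind {ω | ∀ x ∈ X ∪ Y, ¬ (openGraph ω).Reachable y x} ω)) :=
    Finset.sum_congr rfl fun ω _ => by rw [ind_inter]; ring
  rw [r1, r4]
  exact key

open BHK2006 DecisionTree in
/-- **Conditional positive correlation of admissible events with decreasing cluster functionals**
(`X = Y = {x}` in `admissible_twoSet`): for independent bond percolation on a finite graph,
vertices `x, y, z`, a family `T` of vertex sets and an antitone `F ≥ 0`,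
`P(A ∩ {y ↮ x}) · E[F(C_y); y ↮ x] ≤ P(y ↮ x) · E[1_A F(C_y); y ↮ x]`, i.e.
`Cov(1_A, F(C_y) | y ↮ x) ≥ 0` for the admissible event `A = {z ↔ x} ∪ {C(z) ∈ T, z ↮ y}`.
[cite: VandenbergHaggstromKahn2005, Thm. 1.1 (pp. 3–5) and Thm. 1.2 (p. 5)] -/
theorem admissible_cov_nonneg (w : Sym2 V → unitInterval) (z y x : V) (T : Set (Set V))
    (F : Set (Sym2 V) → ℝ) (hF : Antitone F) (hF0 : ∀ a, 0 ≤ F a) :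
    (prodBernoulli w).real
        (admissibleEvent z y {x} T ∩ {ω | ¬ (openGraph ω).Reachable y x}) *
      (∫ ω in {ω : BondConfig V | ¬ (openGraph ω).Reachable y x},
        F (openEdgeCluster ω y) ∂(prodBernoulli w)) ≤
    (prodBernoulli w).real {ω : BondConfig V | ¬ (openGraph ω).Reachable y x} *
      ∫ ω in admissibleEvent z y {x} T ∩ {ω | ¬ (openGraph ω).Reachable y x},
        F (openEdgeCluster ω y) ∂(prodBernoulli w) := by
  have key := admissible_twoSet w z y {x} {x} T F hF hF0
  rw [Set.inter_self, Set.union_self] at key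
  have hs : {ω : BondConfig V | ∀ x' ∈ ({x} : Set V), ¬ (openGraph ω).Reachable y x'} =
      {ω | ¬ (openGraph ω).Reachable y x} := by
    ext ω
    simp only [Set.mem_setOf_eq, Set.mem_singleton_iff, forall_eq]
  rw [hs] at key
  exact key

open BHK2006 DecisionTree in
/-- **Event form** of `admissible_cov_nonneg` for a decreasing event of the *vertex* cluster
`C(y) = openCluster ω y`: for a lower set `L` of vertex sets (e.g. `{B | #(B ∩ A) ≤ j}`, "`C(y)` is
light"), `P(A ∩ {C(y) ∈ L} ∩ {y ↮ x}) · P(y ↮ x) ≥ P(A ∩ {y ↮ x}) · P({C(y) ∈ L} ∩ {y ↮ x})`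
for the admissible event `A = {z ↔ x} ∪ {C(z) ∈ T, z ↮ y}`.
[cite: VandenbergHaggstromKahn2005, Thm. 1.1 (pp. 3–5) and Thm. 1.2 (p. 5)] -/
theorem admissible_clusterEvent_cov_nonneg (w : Sym2 V → unitInterval) (z y x : V)
    (T : Set (Set V)) (L : Set (Set V)) (hL : IsLowerSet L) :
    (prodBernoulli w).real
        (admissibleEvent z y {x} T ∩ {ω | ¬ (openGraph ω).Reachable y x}) *
      (prodBernoulli w).real
        ({ω : BondConfig V | openCluster ω y ∈ L} ∩ {ω | ¬ (openGraph ω).Reachable y x}) ≤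
    (prodBernoulli w).real {ω : BondConfig V | ¬ (openGraph ω).Reachable y x} *
      (prodBernoulli w).real (admissibleEvent z y {x} T ∩ {ω | openCluster ω y ∈ L} ∩
        {ω | ¬ (openGraph ω).Reachable y x}) := by
  classical
  -- the vertex set spanned by an edge set, seen from `y`
  set vs : Set (Sym2 V) → Set V := fun C => {v | v = y ∨ ∃ e ∈ C, v ∈ e} with hvs
  have hvs_mono : Monotone vs := fun C C' hCC' v hv =>
    hv.imp id fun ⟨e, he, hve⟩ => ⟨e, hCC' he, hve⟩
  have hvsC : ∀ ω : BondConfig V, vs (openEdgeCluster ω y) = openCluster ω y := fun ω => by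
    ext v
    simp only [hvs, openCluster, Set.mem_setOf_eq, reachable_iff_exists_mem_openEdgeCluster]
  set F : Set (Sym2 V) → ℝ := fun C => ind L (vs C) with hFdef
  have hF : Antitone F := fun C C' hCC' => by
    simp only [hFdef]
    by_cases h' : vs C' ∈ L
    · rw [ind_of_mem h', ind_of_mem (hL (hvs_mono hCC') h')]
    · rw [ind_of_not_mem h']; exact ind_nonneg _ _
  have hF0 : ∀ a, 0 ≤ F a := fun _ => ind_nonneg _ _
  have key := admissible_cov_nonneg w z y x T F hF hF0
  have hFω : (fun ω : BondConfig V => F (openEdgeCluster ω y)) =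
      {ω : BondConfig V | openCluster ω y ∈ L}.indicator 1 := by
    ext ω
    simp only [hFdef, hvsC]
    by_cases h : openCluster ω y ∈ L
    · rw [ind_of_mem h, Set.indicator_of_mem (show ω ∈ {ω | openCluster ω y ∈ L} from h),
        Pi.one_apply]
    · rw [ind_of_not_mem h, Set.indicator_of_notMem (show ω ∉ {ω | openCluster ω y ∈ L} from h)]
  have hI : ∀ D : Set (BondConfig V), ∫ ω in D, F (openEdgeCluster ω y) ∂(prodBernoulli w) =
      (prodBernoulli w).real ({ω : BondConfig V | openCluster ω y ∈ L} ∩ D) := fun D => by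
    rw [show (fun ω : BondConfig V => F (openEdgeCluster ω y)) =
      {ω : BondConfig V | openCluster ω y ∈ L}.indicator 1 from hFω,
      integral_indicator_one MeasurableSet.of_discrete,
      measureReal_restrict_apply MeasurableSet.of_discrete]
  rw [hI, hI] at key
  rw [show admissibleEvent z y {x} T ∩ {ω | openCluster ω y ∈ L} ∩
      {ω | ¬ (openGraph ω).Reachable y x} = {ω : BondConfig V | openCluster ω y ∈ L} ∩
      (admissibleEvent z y {x} T ∩ {ω | ¬ (openGraph ω).Reachable y x}) by
    ext ω; simp only [Set.mem_inter_iff]; tauto]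
  exact key

open BHK2006 DecisionTree in
/-- **Event form of `admissible_twoSet` with `X = Y`**: for a set `X` of vertices, a family `T`
of vertex sets and a lower set `L` of vertex sets,
`P(A(X) ∩ R_X) · P({C(y) ∈ L} ∩ R_X) ≤ P(R_X) · P(A(X) ∩ {C(y) ∈ L} ∩ R_X)`, i.e.
`Cov(1_{A(X)}, 1{C(y) ∈ L} | y ↮ X) ≥ 0` (`R_X = {y ↮ X}`, `A(X) = admissibleEvent z y X T`).
[cite: VandenbergHaggstromKahn2005, Thm. 1.1 (pp. 3–5) and Thm. 1.2 (p. 5)] -/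
theorem admissible_clusterEvent_cond (w : Sym2 V → unitInterval) (z y : V) (X : Set V)
    (T : Set (Set V)) (L : Set (Set V)) (hL : IsLowerSet L) :
    (prodBernoulli w).real
        (admissibleEvent z y X T ∩ {ω | ∀ x ∈ X, ¬ (openGraph ω).Reachable y x}) *
      (prodBernoulli w).real ({ω : BondConfig V | openCluster ω y ∈ L} ∩
        {ω | ∀ x ∈ X, ¬ (openGraph ω).Reachable y x}) ≤
    (prodBernoulli w).real {ω : BondConfig V | ∀ x ∈ X, ¬ (openGraph ω).Reachable y x} *
      (prodBernoulli w).real (admissibleEvent z y X T ∩ {ω | openCluster ω y ∈ L} ∩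
        {ω | ∀ x ∈ X, ¬ (openGraph ω).Reachable y x}) := by
  classical
  set vs : Set (Sym2 V) → Set V := fun C => {v | v = y ∨ ∃ e ∈ C, v ∈ e} with hvs
  have hvs_mono : Monotone vs := fun C C' hCC' v hv =>
    hv.imp id fun ⟨e, he, hve⟩ => ⟨e, hCC' he, hve⟩
  have hvsC : ∀ ω : BondConfig V, vs (openEdgeCluster ω y) = openCluster ω y := fun ω => by
    ext v
    simp only [hvs, openCluster, Set.mem_setOf_eq, reachable_iff_exists_mem_openEdgeCluster]
  set F : Set (Sym2 V) → ℝ := fun C => ind L (vs C) with hFdef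
  have hF : Antitone F := fun C C' hCC' => by
    simp only [hFdef]
    by_cases h' : vs C' ∈ L
    · rw [ind_of_mem h', ind_of_mem (hL (hvs_mono hCC') h')]
    · rw [ind_of_not_mem h']; exact ind_nonneg _ _
  have hF0 : ∀ a, 0 ≤ F a := fun _ => ind_nonneg _ _
  have key := admissible_twoSet w z y X X T F hF hF0
  rw [Set.inter_self, Set.union_self] at key
  have hFω : (fun ω : BondConfig V => F (openEdgeCluster ω y)) =
      {ω : BondConfig V | openCluster ω y ∈ L}.indicator 1 := by
    ext ω
    simp only [hFdef, hvsC]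
    by_cases h : openCluster ω y ∈ L
    · rw [ind_of_mem h, Set.indicator_of_mem (show ω ∈ {ω | openCluster ω y ∈ L} from h),
        Pi.one_apply]
    · rw [ind_of_not_mem h, Set.indicator_of_notMem (show ω ∉ {ω | openCluster ω y ∈ L} from h)]
  have hI : ∀ D : Set (BondConfig V), ∫ ω in D, F (openEdgeCluster ω y) ∂(prodBernoulli w) =
      (prodBernoulli w).real ({ω : BondConfig V | openCluster ω y ∈ L} ∩ D) := fun D => by
    rw [show (fun ω : BondConfig V => F (openEdgeCluster ω y)) =
      {ω : BondConfig V | openCluster ω y ∈ L}.indicator 1 from hFω,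
      integral_indicator_one MeasurableSet.of_discrete,
      measureReal_restrict_apply MeasurableSet.of_discrete]
  rw [hI, hI] at key
  rw [show admissibleEvent z y X T ∩ {ω | openCluster ω y ∈ L} ∩
      {ω | ∀ x ∈ X, ¬ (openGraph ω).Reachable y x} = {ω : BondConfig V | openCluster ω y ∈ L} ∩
      (admissibleEvent z y X T ∩ {ω | ∀ x ∈ X, ¬ (openGraph ω).Reachable y x}) by
    ext ω; simp only [Set.mem_inter_iff]; tauto]
  exact key

/-- **Complement form: captures of `z` by `y` together with free clusters of `z` of prescribed
shapes are conditionally negatively correlated with the lightness of `C(y)`.**  For `X` a set of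
vertices, `T` a family of vertex sets avoiding `X`, `E = {z ↔ y} ∪ {C(z) ∈ T}` and a lower set `L`:
`P(E ∩ {C(y) ∈ L} ∩ R_X) · P(R_X) ≤ P(E ∩ R_X) · P({C(y) ∈ L} ∩ R_X)` (`R_X = {y ↮ X}`); this is
`admissible_clusterEvent_cond` for the admissible event `{z ↔ X} ∪ {C(z) ∉ T, z ↮ y}`, whose
complement inside `R_X` is `E`.  (With `y = x_k` an observer, `X` the other observers and `T` the
free positions of the marker `z` assigned to `x_k`, this is the row used by the adaptive selection
lemma on the near-critical gluing route.)
[cite: VandenbergHaggstromKahn2005, Thm. 1.1 (pp. 3–5) and Thm. 1.2 (p. 5)] -/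
theorem capture_or_free_clusterEvent_cond (w : Sym2 V → unitInterval) (z y : V) (X : Set V)
    (T : Set (Set V)) (hT : ∀ B ∈ T, ∀ x ∈ X, x ∉ B) (L : Set (Set V)) (hL : IsLowerSet L) :
    (prodBernoulli w).real ({ω : BondConfig V | (openGraph ω).Reachable z y ∨ openCluster ω z ∈ T} ∩
        {ω | openCluster ω y ∈ L} ∩ {ω | ∀ x ∈ X, ¬ (openGraph ω).Reachable y x}) *
      (prodBernoulli w).real {ω : BondConfig V | ∀ x ∈ X, ¬ (openGraph ω).Reachable y x} ≤
    (prodBernoulli w).real ({ω : BondConfig V | (openGraph ω).Reachable z y ∨ openCluster ω z ∈ T} ∩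
        {ω | ∀ x ∈ X, ¬ (openGraph ω).Reachable y x}) *
      (prodBernoulli w).real ({ω : BondConfig V | openCluster ω y ∈ L} ∩
        {ω | ∀ x ∈ X, ¬ (openGraph ω).Reachable y x}) := by
  classical
  set P := prodBernoulli w with hP
  set R : Set (BondConfig V) := {ω | ∀ x ∈ X, ¬ (openGraph ω).Reachable y x} with hR
  set Lv : Set (BondConfig V) := {ω | openCluster ω y ∈ L} with hLv
  set E : Set (BondConfig V) := {ω | (openGraph ω).Reachable z y ∨ openCluster ω z ∈ T} with hE
  set A : Set (BondConfig V) := admissibleEvent z y X Tᶜ with hA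
  -- inside `R_X`, `E` is the complement of the admissible event `A`
  have hAE : ∀ ω, ω ∈ A ∩ R ↔ ω ∈ R ∧ ω ∉ E := by
    intro ω
    simp only [hA, hR, hE, admissibleEvent, Set.mem_inter_iff, Set.mem_setOf_eq,
      Set.mem_compl_iff]
    constructor
    · rintro ⟨hA', hRω⟩
      refine ⟨hRω, ?_⟩
      rintro (hzy | hT')
      · rcases hA' with ⟨x, hx, hzx⟩ | ⟨-, hnzy⟩
        · exact hRω x hx (hzy.symm.trans hzx)
        · exact hnzy hzy
      · rcases hA' with ⟨x, hx, hzx⟩ | ⟨hnT, -⟩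
        · exact hT _ hT' x hx hzx
        · exact hnT hT'
    · rintro ⟨hRω, hnE⟩
      refine ⟨Or.inr ⟨fun h => hnE (Or.inr h), fun h => hnE (Or.inl h)⟩, hRω⟩
  have hAE' : A ∩ R = R \ (E ∩ R) := by
    ext ω
    rw [hAE ω, Set.mem_sdiff, Set.mem_inter_iff]
    tauto
  have hAEL : A ∩ Lv ∩ R = (Lv ∩ R) \ (E ∩ Lv ∩ R) := by
    ext ω
    have := hAE ω
    simp only [Set.mem_inter_iff, Set.mem_sdiff] at this ⊢
    tauto
  have hsub1 : E ∩ R ⊆ R := Set.inter_subset_right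
  have hsub2 : E ∩ Lv ∩ R ⊆ Lv ∩ R := fun ω h => ⟨h.1.2, h.2⟩
  have key := admissible_clusterEvent_cond w z y X Tᶜ L hL
  rw [← hP] at key
  change P.real (A ∩ R) * P.real (Lv ∩ R) ≤ P.real R * P.real (A ∩ Lv ∩ R) at key
  rw [hAE', hAEL, measureReal_sdiff hsub1 MeasurableSet.of_discrete,
    measureReal_sdiff hsub2 MeasurableSet.of_discrete] at key
  show P.real (E ∩ Lv ∩ R) * P.real R ≤ P.real (E ∩ R) * P.real (Lv ∩ R)
  nlinarith [key, measureReal_nonneg (μ := P) (s := R), measureReal_nonneg (μ := P) (s := Lv ∩ R)]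

end Measure

end Literature.Probability.Percolation
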